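import Summits.CriticalPhenomena.Ising3DConformalLimit.Theorems.PerfectScreeningCoulombImpliesNontrivialUpperIsothermOfSusceptibility
import Summits.CriticalPhenomena.Ising3DConformalLimit.Theorems.PerfectScreeningCoulombImpliesNontrivialBlockVariance
import Literature.Probability.LatticeModels.GHSInequality

/-!
# The upper critical isotherm from a one-arm bound (line `SketchPub`, residual S6)

Crux `CoulombImpliesNontrivial` of route `PerfectScreening` (Ising3DConformalLimit), item
stmt-CriticalPhenomena-13885. The line `SketchPub` reduces the crux to the single residual
S6 `stub_upperCriticalIsotherm`: `Coulomb ⟹ m(β_c, h) ≤ A h^{1/5}` ("δ ≤ 5 with amplitude at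
`η = 0`"). This file proves that the residual follows from the **one-arm hyperscaling bound** at
`h = 0`,

  `⟨σ₀⟩⁺_{box L; β_c, 0} ≤ C · L^{-1/2}`  (`L ≥ 1`),

i.e. "the plus-boundary magnetisation at the centre of a critical box is at most of the order of
the square root of the two-point function across it" — a purely zero-field statement of the same
hyperscaling strength (one-arm exponent `≥ Δ_σ = 1/2` at `η = 0`), recorded here as an
alternative, sufficient entrance to the residual.

Proof (`stub_isothermOfOneArm`). For `h > 0` and every `L ≥ 1`:
* `m(β_c,h) ≤ ⟨σ₀⟩⁺_{box L; β_c, h}` (the plus boxes decrease to the plus state,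
  `plusCorr_le_isingCorr_plus_box`);
* GHS concavity in the field (tangent-line form, `boxMag_le_zeroField_add_field_mul`:
  `d/ds ⟨σ₀⟩⁺_{Λ,s} = β Σ_y ⟨σ₀;σ_y⟩⁺_{Λ,s}` is nonincreasing in `s`, `antitoneOn_isingTrunc_field`):
  `⟨σ₀⟩⁺_{Λ;β_c,h} ≤ ⟨σ₀⟩⁺_{Λ;β_c,0} + β_c h Σ_{y ∈ Λ} ⟨σ₀;σ_y⟩⁺_{Λ;β_c,0}`;
* GHS volume monotonicity and `m*(β_c) = 0`: `⟨σ₀;σ_y⟩⁺_{Λ;β_c,0} ≤ ⟨σ₀σ_y⟩_{β_c} = G(y)`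
  (`isingTrunc_plus_box_le_plusExpect`), and the infrared bound `Σ_{y ∈ box L} G(y) ≤ K L²`
  (`sum_box_criticalTwoPoint_le`);
so `m(β_c,h) ≤ C L^{-1/2} + β_c K L² h`, and `L = ⌈h^{-2/5}⌉` gives `m(β_c,h) ≤ (C + 4β_c K) h^{1/5}`
for `0 < h ≤ 1`.
-/

noncomputable section

namespace Summit.CriticalPhenomena.Ising3DConformalLimit.PerfectScreeningCoulombImpliesNontrivial

open Literature.Probability.LatticeModels Filter Set Finset
open scoped Topology BigOperators

/-- **GHS tangent-line bound for the plus-box magnetisation**: for `β, h ≥ 0`,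
`⟨σ₀⟩⁺_{box L;β,h} ≤ ⟨σ₀⟩⁺_{box L;β,0} + β (Σ_{y ∈ box L} ⟨σ₀;σ_y⟩⁺_{box L;β,0}) h`
(fluctuation–response `d/ds⟨σ₀⟩ = βΣ_y⟨σ₀;σ_y⟩` and the GHS monotonicity of the truncated
two-point functions in the field, so the derivative is largest at `s = 0`). -/
theorem boxMag_le_zeroField_add_field_mul {d : ℕ} {β : ℝ} (hβ : 0 ≤ β) {h : ℝ} (hh : 0 ≤ h)
    (L : ℕ) :
    isingExpect (zdGraph d) (box d L) β h .plus (spinAt 0) ≤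
      isingExpect (zdGraph d) (box d L) β 0 .plus (spinAt 0) +
        β * (∑ y ∈ box d L,
          (isingExpect (zdGraph d) (box d L) β 0 .plus (fun σ => spinAt 0 σ * spinAt y σ) -
            isingExpect (zdGraph d) (box d L) β 0 .plus (spinAt 0) *
              isingExpect (zdGraph d) (box d L) β 0 .plus (spinAt y))) * h := by
  set f : ℝ → ℝ := fun s => isingExpect (zdGraph d) (box d L) β s .plus (spinAt 0) with hf
  set D : ℝ := β * ∑ y ∈ box d L,
      (isingExpect (zdGraph d) (box d L) β 0 .plus (fun σ => spinAt 0 σ * spinAt y σ) -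
        isingExpect (zdGraph d) (box d L) β 0 .plus (spinAt 0) *
          isingExpect (zdGraph d) (box d L) β 0 .plus (spinAt y)) with hD
  have hderiv : ∀ s, HasDerivAt f (β * ∑ y ∈ box d L,
      (isingExpect (zdGraph d) (box d L) β s .plus (fun σ => spinAt 0 σ * spinAt y σ) -
        isingExpect (zdGraph d) (box d L) β s .plus (spinAt 0) *
          isingExpect (zdGraph d) (box d L) β s .plus (spinAt y))) s :=
    fun s => hasDerivAt_isingExpect_spinAt_field (zdGraph d) (box d L) β s .plus 0
  have hbound : ∀ s ∈ interior (Icc 0 h), deriv f s ≤ D := by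
    intro s hs
    rw [interior_Icc] at hs
    rw [(hderiv s).deriv, hD]
    refine mul_le_mul_of_nonneg_left (Finset.sum_le_sum fun y hy => ?_) hβ
    exact antitoneOn_isingTrunc_field (zdGraph d) hβ (Or.inr rfl) (zero_mem_box d L) hy
      (Set.self_mem_Ici : (0:ℝ) ∈ Set.Ici 0) (show s ∈ Set.Ici (0:ℝ) from hs.1.le) hs.1.le
  have hcont : ContinuousOn f (Icc 0 h) := fun s _ => (hderiv s).continuousAt.continuousWithinAt
  have hdiff : DifferentiableOn ℝ f (interior (Icc 0 h)) :=
    fun s _ => (hderiv s).differentiableAt.differentiableWithinAt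
  have key := (convex_Icc 0 h).image_sub_le_mul_sub_of_deriv_le hcont hdiff hbound 0
    (left_mem_Icc.2 hh) h (right_mem_Icc.2 hh) hh
  have : f h - f 0 ≤ D * h := by simpa using key
  simp only [hf] at this
  linarith

/-- **The per-box bound**: if `⟨σ₀⟩⁺_{box L; β_c, 0} ≤ C L^{-1/2}` for `L ≥ 1` and
`Σ_{z ∈ box M} ⟨σ₀σ_z⟩_{β_c} ≤ K M²` for `M ≥ 1`, then for `h ≥ 0` and every `L ≥ 1`,
`m(β_c,h) ≤ C L^{-1/2} + β_c K L² h` on `ℤ³` (plus boxes decrease to the plus state; GHS tangent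
bound; GHS volume monotonicity `⟨σ₀;σ_y⟩⁺_{box;β_c,0} ≤ ⟨σ₀σ_y⟩_{β_c}` with `m*(β_c) = 0`). -/
theorem magnetizationInField_le_of_oneArm_box {C K : ℝ}
    (hC : ∀ L : ℕ, 1 ≤ L →
        isingExpect (zdGraph 3) (box 3 L) (criticalBeta 3) 0 .plus (spinAt 0) ≤ C * (L : ℝ) ^ (-(1:ℝ) / 2))
    (hK : ∀ M : ℕ, 1 ≤ M → ∑ z ∈ box 3 M, criticalTwoPoint 3 z ≤ K * (M : ℝ) ^ 2)
    {h : ℝ} (hh : 0 ≤ h) {L : ℕ} (hL : 1 ≤ L) :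
    magnetizationInField 3 (criticalBeta 3) h ≤
      C * (L : ℝ) ^ (-(1:ℝ) / 2) + criticalBeta 3 * K * (L : ℝ) ^ 2 * h := by
  have hβ : 0 < criticalBeta 3 := criticalBeta_pos_holds (d := 3) (by norm_num)
  -- `m(h) ≤ ⟨σ₀⟩⁺_{box L, h}`
  have h1 : magnetizationInField 3 (criticalBeta 3) h ≤
      isingExpect (zdGraph 3) (box 3 L) (criticalBeta 3) h .plus (spinAt 0) := by
    have hle := plusCorr_le_isingCorr_plus_box (d := 3) hβ.le hh
      (A := {0}) (L := L) (Finset.singleton_subset_iff.2 (zero_mem_box 3 L))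
    rw [magnetizationInField_eq_plusCorr]
    refine hle.trans_eq ?_
    simp only [isingCorr]
    congr 1
    funext σ
    simp [spinProduct]
  -- the truncated plus-box two-point functions at `h = 0` are bounded by `G(y)`
  have hm0 : plusExpect 3 (criticalBeta 3) 0 (spinAt 0) = 0 :=
    spontaneousMagnetization_criticalBeta_eq_zero_holds (d := 3) (by norm_num)
  have h2 : ∀ y ∈ box 3 L,
      isingExpect (zdGraph 3) (box 3 L) (criticalBeta 3) 0 .plus (fun σ => spinAt 0 σ * spinAt y σ) -
          isingExpect (zdGraph 3) (box 3 L) (criticalBeta 3) 0 .plus (spinAt 0) *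
            isingExpect (zdGraph 3) (box 3 L) (criticalBeta 3) 0 .plus (spinAt y) ≤
        criticalTwoPoint 3 y := by
    intro y hy
    have hle := isingTrunc_plus_box_le_plusExpect (d := 3) hβ.le le_rfl (zero_mem_box 3 L) hy
    refine hle.trans ?_
    rw [hm0, zero_mul, sub_zero]
    exact le_of_eq rfl
  have h3 : ∑ y ∈ box 3 L,
      (isingExpect (zdGraph 3) (box 3 L) (criticalBeta 3) 0 .plus (fun σ => spinAt 0 σ * spinAt y σ) -
        isingExpect (zdGraph 3) (box 3 L) (criticalBeta 3) 0 .plus (spinAt 0) *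
          isingExpect (zdGraph 3) (box 3 L) (criticalBeta 3) 0 .plus (spinAt y)) ≤ K * (L : ℝ) ^ 2 :=
    (Finset.sum_le_sum h2).trans (hK L hL)
  have h4 := boxMag_le_zeroField_add_field_mul (d := 3) hβ.le hh L
  have h5 := hC L hL
  calc magnetizationInField 3 (criticalBeta 3) h
      ≤ isingExpect (zdGraph 3) (box 3 L) (criticalBeta 3) h .plus (spinAt 0) := h1
    _ ≤ isingExpect (zdGraph 3) (box 3 L) (criticalBeta 3) 0 .plus (spinAt 0) +
        criticalBeta 3 * (∑ y ∈ box 3 L,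
          (isingExpect (zdGraph 3) (box 3 L) (criticalBeta 3) 0 .plus (fun σ => spinAt 0 σ * spinAt y σ) -
            isingExpect (zdGraph 3) (box 3 L) (criticalBeta 3) 0 .plus (spinAt 0) *
              isingExpect (zdGraph 3) (box 3 L) (criticalBeta 3) 0 .plus (spinAt y))) * h := h4
    _ ≤ C * (L : ℝ) ^ (-(1:ℝ) / 2) + criticalBeta 3 * (K * (L : ℝ) ^ 2) * h := by
        gcongr
    _ = C * (L : ℝ) ^ (-(1:ℝ) / 2) + criticalBeta 3 * K * (L : ℝ) ^ 2 * h := by ring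

/-- **The upper critical isotherm from the one-arm hyperscaling bound** (entrance to the residual
S6 of line `SketchPub`): if `⟨σ₀⟩⁺_{box L; β_c(3), 0} ≤ C L^{-1/2}` for all `L ≥ 1`, then
`m(β_c, h) ≤ A h^{1/5}` for `0 < h ≤ 1`, with `A = max C 0 + 4 β_c K` (`K` the constant of the
infrared box sum `Σ_{box M} G ≤ K M²`): take `L = ⌈h^{-2/5}⌉` in
`magnetizationInField_le_of_oneArm_box`. -/
theorem stub_isothermOfOneArm :
    (∃ C : ℝ, ∀ L : ℕ, 1 ≤ L →
        isingExpect (zdGraph 3) (box 3 L) (criticalBeta 3) 0 .plus (spinAt 0) ≤ C * (L : ℝ) ^ (-(1:ℝ) / 2)) →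
      ∃ A h₀ : ℝ, 0 < h₀ ∧ ∀ h : ℝ, 0 < h → h ≤ h₀ →
        magnetizationInField 3 (criticalBeta 3) h ≤ A * h ^ ((1:ℝ) / 5) := by
  rintro ⟨C, hC⟩
  obtain ⟨K, hK0, hK⟩ := sum_box_criticalTwoPoint_le
  have hβ : 0 < criticalBeta 3 := criticalBeta_pos_holds (d := 3) (by norm_num)
  set C' : ℝ := max C 0 with hC'
  have hC'0 : 0 ≤ C' := le_max_right _ _
  have hC' : ∀ L : ℕ, 1 ≤ L →
      isingExpect (zdGraph 3) (box 3 L) (criticalBeta 3) 0 .plus (spinAt 0) ≤ C' * (L : ℝ) ^ (-(1:ℝ) / 2) :=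
    fun L hL => (hC L hL).trans (mul_le_mul_of_nonneg_right (le_max_left _ _) (by positivity))
  refine ⟨C' + 4 * (criticalBeta 3 * K), 1, one_pos, fun h hh hh1 => ?_⟩
  -- the scale `L = ⌈h^{-2/5}⌉`
  set x : ℝ := h ^ (-(2:ℝ) / 5) with hx
  have hx1 : 1 ≤ x := by
    rw [hx]
    exact Real.one_le_rpow_of_pos_of_le_one_of_nonpos hh hh1 (by norm_num)
  have hx0 : 0 < x := one_pos.trans_le hx1
  set L : ℕ := ⌈x⌉₊ with hLdef
  have hL1 : 1 ≤ L := Nat.one_le_ceil_iff.2 hx0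
  have hLx : x ≤ (L : ℝ) := Nat.le_ceil x
  have hL2x : (L : ℝ) ≤ 2 * x := by
    have := Nat.ceil_lt_add_one hx0.le
    rw [← hLdef] at this
    linarith
  have hLpos : (0 : ℝ) < L := hx0.trans_le hLx
  -- `L^{-1/2} ≤ x^{-1/2} = h^{1/5}`
  have hpow1 : (L : ℝ) ^ (-(1:ℝ) / 2) ≤ h ^ ((1:ℝ) / 5) := by
    have h1 : (L : ℝ) ^ (-(1:ℝ) / 2) ≤ x ^ (-(1:ℝ) / 2) :=
      Real.rpow_le_rpow_of_nonpos hx0 hLx (by norm_num)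
    have h2 : x ^ (-(1:ℝ) / 2) = h ^ ((1:ℝ) / 5) := by
      rw [hx, ← Real.rpow_mul hh.le]
      norm_num
    exact h1.trans_eq h2
  -- `L² h ≤ 4 x² h = 4 h^{1/5}`
  have hpow2 : (L : ℝ) ^ 2 * h ≤ 4 * h ^ ((1:ℝ) / 5) := by
    have h1 : (L : ℝ) ^ 2 ≤ 4 * x ^ 2 := by nlinarith
    have h2 : x ^ 2 * h = h ^ ((1:ℝ) / 5) := by
      rw [hx, ← Real.rpow_natCast, ← Real.rpow_mul hh.le]
      conv_lhs => rw [show (h : ℝ) = h ^ (1:ℝ) from (Real.rpow_one h).symm]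
      rw [← Real.rpow_mul hh.le, ← Real.rpow_add hh]
      norm_num
    calc (L : ℝ) ^ 2 * h ≤ 4 * x ^ 2 * h := mul_le_mul_of_nonneg_right h1 hh.le
      _ = 4 * (x ^ 2 * h) := by ring
      _ = 4 * h ^ ((1:ℝ) / 5) := by rw [h2]
  have hmain := magnetizationInField_le_of_oneArm_box hC' hK hh.le hL1
  calc magnetizationInField 3 (criticalBeta 3) h
      ≤ C' * (L : ℝ) ^ (-(1:ℝ) / 2) + criticalBeta 3 * K * (L : ℝ) ^ 2 * h := hmain
    _ = C' * (L : ℝ) ^ (-(1:ℝ) / 2) + criticalBeta 3 * K * ((L : ℝ) ^ 2 * h) := by ring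
    _ ≤ C' * h ^ ((1:ℝ) / 5) + criticalBeta 3 * K * (4 * h ^ ((1:ℝ) / 5)) := by
        gcongr
    _ = (C' + 4 * (criticalBeta 3 * K)) * h ^ ((1:ℝ) / 5) := by ring

end Summit.CriticalPhenomena.Ising3DConformalLimit.PerfectScreeningCoulombImpliesNontrivial

end
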